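import Mathlib
import HarnessLib
import Summits.ResolutionOfSingularities.ResolutionOfSingularities.Theorems.WildQuotientsWildQuotientResolutionS1KillExitDefs
import Summits.ResolutionOfSingularities.ResolutionOfSingularities.Theorems.WildQuotientsWildQuotientResolutionS1KillExitDefsTame
import Summits.ResolutionOfSingularities.ResolutionOfSingularities.Theorems.WildQuotientsWildQuotientResolutionS1aGameFrameWFFrom
import Summits.ResolutionOfSingularities.ResolutionOfSingularities.Theorems.WildQuotientsWildQuotientResolutionS1aGameWins
import Summits.ResolutionOfSingularities.ResolutionOfSingularities.Theorems.WildQuotientsWildQuotientResolutionS1W1NPrint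
import Summits.ResolutionOfSingularities.ResolutionOfSingularities.Theorems.WildQuotientsWildQuotientResolutionS1aStubInitialAtlas
import Summits.ResolutionOfSingularities.ResolutionOfSingularities.Theorems.WildQuotientsWildQuotientResolutionS1aExitAssemblyTame
import Summits.ResolutionOfSingularities.ResolutionOfSingularities.Theorems.WildQuotientsWildQuotientResolutionS1aDoorOfBerghRydh
import Summits.ResolutionOfSingularities.ResolutionOfSingularities.Theses.WildQuotients
import Literature.AlgebraicGeometry.Resolution.TameQuotientSingularitiesResolution

/-!
# Line L — FRAME ASSEMBLY IN WINS FORM and THE FRAME THEOREM (crux ⇐ door + winning strategy)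

[OURS · L1 W4.5c] — NOT statements of the manuscript; counted 0 post-V5; AI-written, weaker than expert review.
lead-1's `GameFrame.Wins` (p586880: terminal models win; a model with an admissible centre all of whose moves win,
wins) is the weakest strategy statement that feeds the frame (`killTameModel_of_wins_prime`). This module is the
Wins-form frame assembly + the reduction of the sub-crux to DOOR + WINNING STRATEGY, for skeleton v6 of
`Cruxes/CyclicQuotientFourfolds/Lines/s1a_logminvertex.lean` to cite BY NAME:

* `FrameWins.WinningStrategy p` — «the initial model of every faithful cyclic datum over a perfect field of
  characteristic `p` (dim ≤ 4) WINS», the binder block of the registered `stub_strategy` verbatim with conclusion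
  `Wins … (GModel.initial hq h₀)`; `FrameWins.DoorStatement` — the door stub's statement verbatim;
* `FrameWins.globalKillTame_of_winningStrategy : p.Prime → (W1NPrint p → WinningStrategy p) → W1NPrint p → GlobalKillTame p`
  — proof = `S1.stub_frameAssembly`'s instance plumbing (p586291) + `S1.stub_initialAtlas` (p586632) +
  `GameFrame.killTameModel_of_wins_initial` (p586880);
* **`FrameWins.cyclicQuotientFourfolds_of_door_of_wins`** : door → (∀ p prime, W1NPrint p → WinningStrategy p) →
  `CyclicQuotientFourfolds` (through `ExitAssemblyTame.stub_exitAssemblyTame_holds` p586833 and `S1.stub_W1N_print`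
  p578139) and `…_of_berghRydh_of_wins` (door discharged conditionally by `DoorLadder.door_of_berghRydh`, p586600):
  modulo the published tame-quotient theorem the sub-crux IS the winning-strategy statement.
-/

-- single-problem summit: the doubled namespace component `ResolutionOfSingularities` is forced
set_option linter.dupNamespace false

noncomputable section

open CategoryTheory Limits AlgebraicGeometry TopologicalSpace
open Literature.AlgebraicGeometry.Resolution Literature.AlgebraicGeometry.RelativeSpec

namespace Summit.ResolutionOfSingularities.ResolutionOfSingularities.Theorems.WildQuotientResolution.S1.FrameWins

open Summit.ResolutionOfSingularities.ResolutionOfSingularities.Theorems.WildQuotientResolution.S1.NodeAtlas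
open Summit.ResolutionOfSingularities.ResolutionOfSingularities.Theorems.WildQuotientResolution.S1.MoveStep
open Summit.ResolutionOfSingularities.ResolutionOfSingularities.Theorems.WildQuotientResolution.S1.GameFrame

/-- **WINNING STRATEGY at characteristic `p`**: the initial model of every faithful cyclic datum (order `p`, perfect
ground field of characteristic `p`, `dim X₁ ≤ 4`, with a node atlas) WINS the kill game. Binder block = the registered
`stub_strategy` of skeleton 47061bb625717adf verbatim (minus the `W1NPrint p` premise, supplied separately);
conclusion in lead-1's `Wins` form. [OURS · L1 W4.5c] -/
def WinningStrategy (p : ℕ) : Prop :=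
  ∀ (k : Type) [Field k] [CharP k p] [PerfectField k] (X' X₁ : Scheme.{0})
    (f : X₁ ⟶ Spec (.of k)) (q : X' ⟶ X₁) (G : Type) [Group G] [Finite G]
    (ρ : G →* Aut X'), Nat.card G = p → IsSeparated f → LocallyOfFiniteType f → QuasiCompact f →
    IsIntegral X₁ → ∀ [IsIntegral X'], Scheme.IsRegular X' → IsFinite q → Function.Surjective q.base →
    (∃ U : X₁.Opens, Dense (U : Set X₁) ∧ Etale (q ∣_ U)) →
    ∀ (hq : ∀ g : G, (ρ g).hom ≫ q = q),
    (∀ x y : X', q.base x = q.base y → ∃ g : G, (ρ g).hom.base x = y) →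
    topologicalKrullDim X₁ ≤ 4 → Function.Injective ρ →
    ∀ (g₀ : G), (∀ g : G, g ∈ Subgroup.zpowers g₀) → ∀ [IsLocallyNoetherian X']
      (h₀ : NodeAtlas p (⟨ρ, hq⟩ : ActionOver q G) g₀),
      Wins p q G ρ g₀ (GModel.initial hq h₀)

/-- **THE DOOR** — statement of the registered stub `stub_tameQuotientResolution`, verbatim. [OURS · L1 W4.5c] -/
def DoorStatement : Prop :=
  ∀ (k : Type) [Field k] [PerfectField k] (Y : Scheme.{0}) (g : Y ⟶ Spec (.of k))
    [IsIntegral Y] [IsSeparated g] [LocallyOfFiniteType g] [QuasiCompact g],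
    S1.LocallyTameRootRegular Y → topologicalKrullDim Y ≤ 4 →
    Literature.AlgebraicGeometry.Resolution.Scheme.HasResolution Y

/-- **FRAME ASSEMBLY, WINS FORM**: a winning strategy at `p` (given the W1-N fact) yields `GlobalKillTame p`.
Instance plumbing verbatim from `S1.stub_frameAssembly` (p586291); the initial node atlas from `S1.stub_initialAtlas`
(p586632); the frame from `GameFrame.killTameModel_of_wins_initial` (p586880). [OURS · L1 W4.5c] -/
theorem globalKillTame_of_winningStrategy (p : ℕ) (hp : p.Prime) (hstrat : S1.W1NPrint p → WinningStrategy p)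
    (hW : S1.W1NPrint p) : S1.GlobalKillTame p := by
  intro k _ _ _ X' X₁ f q G _ _ ρ hcard hfsep hfft hfqc hX₁ hX' hreg hqfin hsurj hU hq horb hdim hinj
  classical
  haveI := hfsep
  haveI := hfft
  haveI := hfqc
  haveI := hX₁
  haveI := hX'
  haveI := hqfin
  haveI : X₁.IsSeparated := ⟨by rw [← terminal.comp_from f]; infer_instance⟩
  haveI : IsLocallyNoetherian X₁ := LocallyOfFiniteType.isLocallyNoetherian f
  haveI : IsLocallyNoetherian X' := LocallyOfFiniteType.isLocallyNoetherian q
  haveI : Fact p.Prime := ⟨hp⟩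
  haveI : IsCyclic G := isCyclic_of_prime_card hcard
  obtain ⟨g₀, hg₀⟩ := IsCyclic.exists_generator (α := G)
  have hg₀p : g₀ ^ p = 1 := by rw [← hcard]; exact pow_card_eq_one'
  have h₀ : NodeAtlas p (⟨ρ, hq⟩ : ActionOver q G) g₀ := S1.stub_initialAtlas p hp.pos q G ρ g₀ hg₀p hq hreg
  exact killTameModel_of_wins_initial hp hg₀ hq h₀
    (hstrat hW k X' X₁ f q G ρ hcard hfsep hfft hfqc hX₁ hreg hqfin hsurj hU hq horb hdim hinj g₀ hg₀ h₀)

/-- **THE FRAME THEOREM (Wins form).** Door + winning strategy at every prime ⇒ the sub-crux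
`CyclicQuotientFourfolds`. [OURS · L1 W4.5c] -/
theorem cyclicQuotientFourfolds_of_door_of_wins (hD : DoorStatement)
    (hS : ∀ p : ℕ, p.Prime → S1.W1NPrint p → WinningStrategy p) :
    Summit.ResolutionOfSingularities.ResolutionOfSingularities.Theses.WildQuotients.CyclicQuotientFourfolds :=
  fun p hp =>
    ExitAssemblyTame.stub_exitAssemblyTame_holds p hp hD
      (globalKillTame_of_winningStrategy p hp (hS p hp) (S1.stub_W1N_print p hp))

/-- Pointwise: door + winning strategy at `p` ⇒ `CyclicQuotientAt p`. [OURS · L1 W4.5c] -/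
theorem cyclicQuotientAt_of_door_of_wins (hD : DoorStatement) (p : ℕ) (hp : p.Prime)
    (hS : S1.W1NPrint p → WinningStrategy p) : S1.CyclicQuotientAt p :=
  ExitAssemblyTame.stub_exitAssemblyTame_holds p hp hD
    (globalKillTame_of_winningStrategy p hp hS (S1.stub_W1N_print p hp))

/-- **Modulo Bergh–Rydh 2019 (named fact) the sub-crux IS the winning-strategy statement.** [OURS · L1 W4.5c] -/
theorem cyclicQuotientFourfolds_of_berghRydh_of_wins (hBR : BerghRydh2019_diagonalizableQuotientResolution)
    (hS : ∀ p : ℕ, p.Prime → S1.W1NPrint p → WinningStrategy p) :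
    Summit.ResolutionOfSingularities.ResolutionOfSingularities.Theses.WildQuotients.CyclicQuotientFourfolds :=
  cyclicQuotientFourfolds_of_door_of_wins (DoorLadder.door_of_berghRydh hBR) hS

end Summit.ResolutionOfSingularities.ResolutionOfSingularities.Theorems.WildQuotientResolution.S1.FrameWins

end
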